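import Mathlib
import HarnessLib
import Summits.Langlands.Langlands.Theses.SkinnerWilesDefectOne
import Summits.Langlands.Langlands.Theorems.ReducibleOrdinaryProModular.Negative.LevelAndRamification
import Literature.NumberTheory.GaloisRepresentations.NearlyOrdinaryDeformationRing
import Literature.NumberTheory.GaloisRepresentations.GaloisCohomology
import Summits.Langlands.Langlands.Theorems.SkinnerWilesDefectOneReducibleOrdinaryProModularDefs

/-! # Thin Frobenius conditions, residual lemmas for models, and the Steinberg pin: helper file
# `…SmallReducibleSteinbergLocusThinAux` for stub `stub_smallReducibleSteinbergLocusAligned`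
# (line steinberg-hyperplane, crux ReducibleOrdinaryProModular, stmt-Langlands-12919)

Sorry-free infrastructure of the heart stub S3' (`stub_smallReducibleSteinbergLocusAligned`):

* §1 the Čebotarev window `chebotarevWindow p ρ₀ = {τ | ResTrivial p ρ₀ τ ∧ CycloTrivialModP p τ}` IS
  (the carrier of) an open normal subgroup `ker (ρ₀ mod 𝔪_O) ⊓ ker (χ_p mod p)` of `Γ_F` as soon as `ρ₀`
  is the integral model of a continuous `ρ` in the valuation ring of `ℚ̄_p` (`isOpen_chebotarevWindow`,
  `coe_ker_inf_ker_eq_chebotarevWindow`, `exists_subgroup_coe_eq_chebotarevWindow`);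
  hence `B := ∅` is thin (`isThin_empty`) and, more usefully, every pull-back of a conjugation-stable
  subset of a finite quotient `Γ_F ⧸ N` (`N` open normal inside the window) missing the class of some
  window element is thin (`isThin_preimage`) — the shape in which S1 consumes `B`;
* §2 what `ModelData.Models.realizes` gives for a BARE ring map `φ : R → ℚ̄_p` (no continuity, no
  `𝒪`-linearity): `ρ σ = 1 ⇒ ρ̄_𝒟 σ = 1` (`Models.residual_apply_eq_one`), so the residual datum of
  any model is unramified wherever `ρ` is (`Models.residual_isUnramifiedAt`) — the entries of
  `ρ_𝒟 σ - 1` lie in `ker φ ⊆ 𝔪_R`;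
* §3 **the Steinberg pin at prime level** (the lever `steinberg_hyperplane` of the Defs file, read on
  `Spec R_𝒟`): for `𝔮 ∈ steinbergLocus 𝓡 w` and ANY frame `P` over `Frac(R/𝔮)` upper-triangularising
  `ρ_𝒟 mod 𝔮` at an arithmetic Frobenius `σ` at `𝔓 ∣ w` (in particular any GLOBAL reducible frame of a
  `𝔮 ∈ reducibleLocus ∩ steinbergLocus w`), the diagonal entries `a = (P⁻¹ρσP)₀₀`, `d = (P⁻¹ρσP)₁₁`
  satisfy `a = N w · d ∨ d = N w · a` (`steinbergPin_of_apply`, `steinbergPin`; character form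
  `steinbergPin_diagChar`; ratio form `Ψ(σ) = q^{±1}` when `q ≠ 0` in `Frac(R/𝔮)`, `steinbergPin_ratio`).
  Mechanism: `IsSteinbergShapedAt` supplies a possibly DIFFERENT local frame `P'` with `a' = N w · d'`;
  two upper-triangular forms of ONE `2 × 2` matrix over a domain have equal trace and determinant, so
  `(a − a')(a − d') = 0` and `{a, d} = {a', d'}` (`diag_eq_or_eq_swap_of_conj`) — what the heart's dimension
  count consumes (reducible Steinberg-shaped points lie on `Ψ(Frob_w) = q_w^{±1}`); §4 the registered wrapper.

History (5 lines).  Wave 1 found the heart stub as first registered (`stub_smallReducibleSteinbergLocus`,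
no bound on aligned places) FALSE: the lift `Ψ⁺ = ν̃·ε` of `Ψ̄` lies on EVERY Taylor–Steinberg hyperplane
`{Ψ(Frob_{v₀}) = q_{v₀}}`, and its stratum of the reducible locus is a Steinberg-shaped family of Krull
dimension `t + 2`, `t = #`aligned places (witness `V₅(11a1)|Γ_{ℚ(√−2)}`, `t = 2`).  Paper argument and
reshape: lead evidence file `line-steinberg-hyperplane-S3-misstated.md`; the corrected stub carries
`AtMostOneAlignedPlace` (Defs §4).  §§1–2 below are the kernel-checked part of that audit (def-free).
-/

set_option linter.dupNamespace false
set_option autoImplicit false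

namespace Summit.Langlands.Langlands.Cruxes.ReducibleOrdinaryProModular.SteinbergHyperplane

open scoped NumberField MatrixGroups
open Filter NumberField IsDedekindDomain Field Polynomial Matrix
open Literature.NumberTheory.Automorphic Literature.NumberTheory.Automorphic.BigHeckeGLn
open Literature.NumberTheory.GaloisRepresentations
open Summit.Langlands.Langlands.Theses.SkinnerWilesDefectOne

noncomputable section

/-! ## 1. The Čebotarev window is an open normal subgroup; thin sets
No new definitions (helper files under `Theorems/` are theorem-only): the window subgroup is written
literally as `ker (GL₂(residue) ∘ ρ₀) ⊓ ker (χ_p mod p)`; the API goes through the SET `chebotarevWindow p ρ₀`. -/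

section Window

variable {F : Type} [Field F] (p : ℕ) [Fact p.Prime]
variable {O : ValuationSubring (PadicAlgCl p)}

/-- `ResTrivial p ρ₀ τ` is membership of `τ` in the kernel of `ρ₀ mod 𝔪_O` (a normal subgroup). [folklore] -/
theorem mem_ker_residue_comp_iff (ρ₀ : absoluteGaloisGroup F →* GL (Fin 2) O) (τ : absoluteGaloisGroup F) :
    τ ∈ ((Matrix.GeneralLinearGroup.map (IsLocalRing.residue O)).comp ρ₀).ker ↔ ResTrivial p ρ₀ τ := by
  rw [MonoidHom.mem_ker, MonoidHom.comp_apply, ResTrivial, Units.ext_iff, ← Matrix.ext_iff]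
  refine forall_congr' fun i => forall_congr' fun j => ?_
  rw [Matrix.GeneralLinearGroup.map_apply, Units.val_one, ← IsLocalRing.residue_eq_zero_iff,
    map_sub, sub_eq_zero]
  have h1 : IsLocalRing.residue O ((1 : Matrix (Fin 2) (Fin 2) O) i j) =
      (1 : Matrix (Fin 2) (Fin 2) (IsLocalRing.ResidueField O)) i j := by
    rw [Matrix.one_apply, Matrix.one_apply]
    split_ifs <;> simp
  rw [h1]

/-- `CycloTrivialModP p τ` is membership of `τ` in the kernel of the mod-`p` cyclotomic character. [folklore] -/
theorem mem_ker_cyclotomicCharacterModPow_iff (τ : absoluteGaloisGroup F) :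
    τ ∈ (cyclotomicCharacterModPow F p 1).ker ↔ CycloTrivialModP (F := F) p τ := by
  rw [MonoidHom.mem_ker, cyclotomicCharacterModPow_apply, CycloTrivialModP,
    PadicInt.maximalIdeal_eq_span_p, ← pow_one (p : ℤ_[p]), ← PadicInt.ker_toZModPow,
    RingHom.mem_ker, map_sub, map_one, sub_eq_zero]

/-- **The Čebotarev window is the carrier of the subgroup** `G₀ = ker (ρ₀ mod 𝔪_O) ⊓ ker (χ_p mod p)`
`= Gal(F̄/F(ρ̄, μ_p))` — an intersection of two kernels, hence normal (`normal_ker_inf_ker`). [folklore] -/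
theorem coe_ker_inf_ker_eq_chebotarevWindow (ρ₀ : absoluteGaloisGroup F →* GL (Fin 2) O) :
    ((((Matrix.GeneralLinearGroup.map (IsLocalRing.residue O)).comp ρ₀).ker ⊓
        (cyclotomicCharacterModPow F p 1).ker : Subgroup (absoluteGaloisGroup F)) :
      Set (absoluteGaloisGroup F)) = chebotarevWindow p ρ₀ := by
  ext τ
  rw [SetLike.mem_coe, Subgroup.mem_inf, mem_ker_residue_comp_iff,
    mem_ker_cyclotomicCharacterModPow_iff]
  rfl

/-- The window subgroup is normal (instance inference: kernels and their meets are normal). [folklore] -/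
theorem normal_ker_inf_ker (ρ₀ : absoluteGaloisGroup F →* GL (Fin 2) O) :
    (((Matrix.GeneralLinearGroup.map (IsLocalRing.residue O)).comp ρ₀).ker ⊓
      (cyclotomicCharacterModPow F p 1).ker : Subgroup (absoluteGaloisGroup F)).Normal :=
  inferInstance

/-- The mod-`p` cyclotomic kernel is open (continuity of `χ_p mod p`). [folklore] -/
theorem isOpen_ker_cyclotomicCharacterModPow :
    IsOpen (((cyclotomicCharacterModPow F p 1).ker : Subgroup (absoluteGaloisGroup F)) :
      Set (absoluteGaloisGroup F)) := by
  rw [MonoidHom.coe_ker]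
  exact (isOpen_discrete _).preimage (continuous_cyclotomicCharacterModPow F p 1)

variable {p}

/-- In the valuation ring `O` of `ℚ̄_p`, `a ∈ 𝔪_O ↔ v(a) < 1`. [folklore] -/
theorem mem_maximalIdeal_iff_v_lt_one
    (hO : O = (Valued.v : Valuation (PadicAlgCl p) NNReal).valuationSubring) (a : O) :
    a ∈ IsLocalRing.maximalIdeal O ↔ Valued.v (a : PadicAlgCl p) < 1 := by
  subst hO
  exact Valuation.mem_maximalIdeal_iff (PadicAlgCl p) Valued.v

/-- For the integral model `ρ₀` of a continuous `ρ` in the valuation ring of `ℚ̄_p`, the residually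
trivial subgroup `ker (ρ₀ mod 𝔪_O)` is open: it is the preimage under the continuous `ρ` of the open set
of matrices `≡ 1 (mod 𝔪)`, `𝔪 = {v < 1}` being open. [folklore] -/
theorem isOpen_ker_residue_comp (hO : O = (Valued.v : Valuation (PadicAlgCl p) NNReal).valuationSubring)
    {ρ : FramedGaloisRep F (PadicAlgCl p) 2} {ρ₀ : absoluteGaloisGroup F →* GL (Fin 2) O}
    (hmod : ρ.HasUpperTriangularIntegralModel ρ₀) :
    IsOpen ((((Matrix.GeneralLinearGroup.map (IsLocalRing.residue O)).comp ρ₀).ker :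
      Subgroup (absoluteGaloisGroup F)) : Set (absoluteGaloisGroup F)) := by
  have hset : ((((Matrix.GeneralLinearGroup.map (IsLocalRing.residue O)).comp ρ₀).ker :
      Subgroup (absoluteGaloisGroup F)) : Set (absoluteGaloisGroup F)) =
      ⋂ i : Fin 2, ⋂ j : Fin 2,
        (fun τ => (ρ τ).val i j - (1 : Matrix (Fin 2) (Fin 2) (PadicAlgCl p)) i j) ⁻¹'
          {x : PadicAlgCl p | ‖x‖ < 1} := by
    ext τ
    simp only [SetLike.mem_coe, mem_ker_residue_comp_iff, ResTrivial, Set.mem_iInter,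
      Set.mem_preimage, Set.mem_setOf_eq]
    refine forall_congr' fun i => forall_congr' fun j => ?_
    rw [mem_maximalIdeal_iff_v_lt_one hO, PadicAlgCl.valuation_def, ← NNReal.coe_lt_coe,
      coe_nnnorm, NNReal.coe_one]
    have hij : (((ρ₀ τ).val i j : O) : PadicAlgCl p) = (ρ τ).val i j := by
      rw [← hmod.1 τ, Matrix.GeneralLinearGroup.map_apply]
      rfl
    have h1 : (((1 : Matrix (Fin 2) (Fin 2) O) i j : O) : PadicAlgCl p) =
        (1 : Matrix (Fin 2) (Fin 2) (PadicAlgCl p)) i j := by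
      rw [Matrix.one_apply, Matrix.one_apply]
      split_ifs <;> rfl
    have hsub : (((ρ₀ τ).val i j - (1 : Matrix (Fin 2) (Fin 2) O) i j : O) : PadicAlgCl p) =
        (((ρ₀ τ).val i j : O) : PadicAlgCl p) - (((1 : Matrix (Fin 2) (Fin 2) O) i j : O) :
          PadicAlgCl p) := rfl
    rw [hsub, hij, h1]
  rw [hset]
  refine isOpen_iInter_of_finite fun i => isOpen_iInter_of_finite fun j => ?_
  refine (isOpen_lt continuous_norm continuous_const).preimage ?_
  exact ((Units.continuous_val.comp ρ.continuous).matrix_elem i j).sub continuous_const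

/-- **The Čebotarev window is open** (hence of finite index) for the integral model of a continuous
`ρ`. [folklore] -/
theorem isOpen_chebotarevWindow (hO : O = (Valued.v : Valuation (PadicAlgCl p) NNReal).valuationSubring)
    {ρ : FramedGaloisRep F (PadicAlgCl p) 2} {ρ₀ : absoluteGaloisGroup F →* GL (Fin 2) O}
    (hmod : ρ.HasUpperTriangularIntegralModel ρ₀) :
    IsOpen (chebotarevWindow p ρ₀) := by
  rw [← coe_ker_inf_ker_eq_chebotarevWindow, Subgroup.coe_inf]
  exact (isOpen_ker_residue_comp hO hmod).inter (isOpen_ker_cyclotomicCharacterModPow p)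

/-- **The window is an open normal subgroup** (packaged for `IsThin`'s `G₀`). [folklore] -/
theorem exists_subgroup_coe_eq_chebotarevWindow (hO : O = (Valued.v : Valuation (PadicAlgCl p) NNReal).valuationSubring)
    {ρ : FramedGaloisRep F (PadicAlgCl p) 2} {ρ₀ : absoluteGaloisGroup F →* GL (Fin 2) O}
    (hmod : ρ.HasUpperTriangularIntegralModel ρ₀) :
    ∃ G₀ : Subgroup (absoluteGaloisGroup F), G₀.Normal ∧ IsOpen (G₀ : Set (absoluteGaloisGroup F)) ∧
      (G₀ : Set (absoluteGaloisGroup F)) = chebotarevWindow p ρ₀ :=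
  ⟨_, normal_ker_inf_ker p ρ₀,
    (coe_ker_inf_ker_eq_chebotarevWindow p ρ₀).symm ▸ isOpen_chebotarevWindow hO hmod,
    coe_ker_inf_ker_eq_chebotarevWindow p ρ₀⟩

/-- **Thin sets from finite quotients.**  Let `N` be an open normal subgroup of `Γ_F` inside the
window and `S ⊆ Γ_F ⧸ N` a conjugation-stable subset missing the class of some window element `τ`.
Then `B := (Γ_F → Γ_F ⧸ N)⁻¹(S)` is thin.  (All the card's avoidance conditions — directions in
`Gal(F̃_n/F)`, non-splitting in `ℤ/p`-layers — are of this form.) [folklore] -/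
theorem isThin_preimage {ρ₀ : absoluteGaloisGroup F →* GL (Fin 2) O}
    (N : Subgroup (absoluteGaloisGroup F)) [N.Normal] (hN : IsOpen (N : Set (absoluteGaloisGroup F)))
    (hle : (N : Set (absoluteGaloisGroup F)) ⊆ chebotarevWindow p ρ₀)
    (S : Set (absoluteGaloisGroup F ⧸ N))
    (hS : ∀ (g : absoluteGaloisGroup F), ∀ x ∈ S,
      (QuotientGroup.mk g : absoluteGaloisGroup F ⧸ N) * x * (QuotientGroup.mk g)⁻¹ ∈ S)
    (hτ : ∃ τ ∈ chebotarevWindow p ρ₀, (QuotientGroup.mk τ : absoluteGaloisGroup F ⧸ N) ∉ S) :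
    IsThin p ρ₀ ((QuotientGroup.mk : absoluteGaloisGroup F → absoluteGaloisGroup F ⧸ N) ⁻¹' S) := by
  obtain ⟨τ, hτG, hτS⟩ := hτ
  refine ⟨_, N, coe_ker_inf_ker_eq_chebotarevWindow p ρ₀, inferInstance, hN, ?_, ?_, ?_, τ, ?_, ?_⟩
  · intro x hx
    rw [← SetLike.mem_coe, coe_ker_inf_ker_eq_chebotarevWindow]
    exact hle hx
  · intro σ hσ n hn
    rw [Set.mem_preimage] at hσ ⊢
    rwa [QuotientGroup.mk_mul, (QuotientGroup.eq_one_iff n).mpr hn, mul_one]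
  · intro g σ hσ
    rw [Set.mem_preimage] at hσ ⊢
    rw [QuotientGroup.mk_mul, QuotientGroup.mk_mul, QuotientGroup.mk_inv]
    exact hS g _ hσ
  · rw [← SetLike.mem_coe, coe_ker_inf_ker_eq_chebotarevWindow]
    exact hτG
  · intro n hn
    rw [Set.mem_preimage, QuotientGroup.mk_mul, (QuotientGroup.eq_one_iff n).mpr hn, mul_one]
    exact hτS

/-- **`B := ∅` is thin** (so the `∃ B` half of the stub is constructible: the statement with `B = ∅`
is the bare claim "every model at a Taylor–Steinberg level has small reducible Steinberg locus"). [folklore] -/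
theorem isThin_empty (hO : O = (Valued.v : Valuation (PadicAlgCl p) NNReal).valuationSubring)
    {ρ : FramedGaloisRep F (PadicAlgCl p) 2} {ρ₀ : absoluteGaloisGroup F →* GL (Fin 2) O}
    (hmod : ρ.HasUpperTriangularIntegralModel ρ₀) :
    IsThin p ρ₀ (∅ : Set (absoluteGaloisGroup F)) := by
  have h := isThin_preimage (p := p) (ρ₀ := ρ₀) _
    ((coe_ker_inf_ker_eq_chebotarevWindow p ρ₀).symm ▸ isOpen_chebotarevWindow hO hmod)
    (coe_ker_inf_ker_eq_chebotarevWindow p ρ₀).subset ∅ (fun _ _ hx => hx.elim)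
    ⟨1, (coe_ker_inf_ker_eq_chebotarevWindow p ρ₀).subset (one_mem _), fun h => h⟩
  rwa [Set.preimage_empty] at h

end Window

/-! ## 2. What `Models.realizes` gives for a bare ring map `φ` -/

section Models

variable {F : Type} [Field F] [NumberField F] {p : ℕ} [Fact p.Prime]
variable {O : ValuationSubring (PadicAlgCl p)}

/-- **`realizes` transports `ρ σ = 1` to the residual datum**, for ANY ring map `φ : R → ℚ̄_p`:
`GL₂(φ)(ρ_𝒟 σ) = P⁻¹ ρ(σ) P = 1` puts the entries of `ρ_𝒟 σ - 1` in `ker φ ⊆ 𝔪_R = ker π`, so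
`ρ̄_𝒟 σ = GL₂(π)(ρ_𝒟 σ) = 1`. [folklore] -/
theorem ModelData.Models.residual_apply_eq_one {M : ModelData F p}
    {ρ : FramedGaloisRep F (PadicAlgCl p) 2} {ρ₀ : absoluteGaloisGroup F →* GL (Fin 2) O}
    {S : Set (HeightOneSpectrum (𝓞 F))} (hM : M.Models ρ ρ₀ S) {σ : absoluteGaloisGroup F}
    (hσ : ρ σ = 1) : M.𝒟.residual σ = 1 := by
  obtain ⟨P, hP⟩ := hM.realizes
  have h := hP σ
  rw [hσ, mul_one, inv_mul_cancel] at h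
  have hres := DFunLike.congr_fun M.𝓡.isLift.residual_eq σ
  rw [MonoidHom.comp_apply] at hres
  rw [← hres, Units.ext_iff, ← Matrix.ext_iff]
  intro i j
  have hij : M.φ ((M.𝓡.ρ σ).val i j) = (1 : Matrix (Fin 2) (Fin 2) (PadicAlgCl p)) i j := by
    rw [← Matrix.GeneralLinearGroup.map_apply M.φ i j (M.𝓡.ρ σ), h, Units.val_one]
  have hker : (M.𝓡.ρ σ).val i j - (1 : Matrix (Fin 2) (Fin 2) M.𝓡.R) i j ∈ RingHom.ker M.φ := by
    rw [RingHom.mem_ker, map_sub, hij, Matrix.one_apply, Matrix.one_apply]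
    split_ifs <;> simp
  have hne : RingHom.ker M.φ ≠ ⊤ := RingHom.ker_ne_top M.φ
  have hmax : (M.𝓡.ρ σ).val i j - (1 : Matrix (Fin 2) (Fin 2) M.𝓡.R) i j ∈
      RingHom.ker (M.𝓡.π : M.𝓡.R →+* M.k) := by
    rw [M.𝓡.ker_π]
    exact IsLocalRing.le_maximalIdeal hne hker
  rw [RingHom.mem_ker, map_sub, sub_eq_zero] at hmax
  rw [Matrix.GeneralLinearGroup.map_apply, Units.val_one]
  change (M.𝓡.π : M.𝓡.R →+* M.k) ((M.𝓡.ρ σ).val i j) = _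
  rw [hmax, Matrix.one_apply, Matrix.one_apply]
  split_ifs <;> simp

/-- Hence the residual datum of ANY model is unramified wherever `ρ` is — in particular at the
Taylor–Steinberg place `v₀` (no perverse model has `ρ̄_𝒟` ramified at `v₀`). [folklore] -/
theorem ModelData.Models.residual_isUnramifiedAt {M : ModelData F p}
    {ρ : FramedGaloisRep F (PadicAlgCl p) 2} {ρ₀ : absoluteGaloisGroup F →* GL (Fin 2) O}
    {S : Set (HeightOneSpectrum (𝓞 F))} (hM : M.Models ρ ρ₀ S) {w : HeightOneSpectrum (𝓞 F)}
    (hw : ρ.IsUnramifiedAt w) : Deformation.IsUnramifiedAt w M.𝒟.residual := by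
  rw [FramedGaloisRep.isUnramifiedAt_iff_toMonoidHom] at hw
  exact fun 𝔓 h𝔓 σ hσ => hM.residual_apply_eq_one (hw 𝔓 h𝔓 σ hσ)

end Models

/-! ## 3. The Steinberg pin at Steinberg-shaped primes -/

section Pin

/-- **Two upper-triangular forms of one `2 × 2` matrix have the same diagonal up to order.**  If
`P⁻¹ M P = (a ∗; 0 d)` and `P'⁻¹ M P' = (a' ∗; 0 d')` over a domain, then `(a, d) = (a', d')` or
`(a, d) = (d', a')`: traces and determinants agree (`Matrix.trace_units_conj'`, `Matrix.det_units_conj'`),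
so `(a − a')(a − d') = a² − a(a + d) + ad = 0` (semisimplification of a 2-dimensional representation,
one matrix at a time; only the eigenvalue MULTISET is frame-independent). [folklore] -/
theorem diag_eq_or_eq_swap_of_conj {K : Type*} [CommRing K] [IsDomain K] (M P P' : GL (Fin 2) K)
    (hP : (P⁻¹ * M * P).val 1 0 = 0) (hP' : (P'⁻¹ * M * P').val 1 0 = 0) :
    ((P⁻¹ * M * P).val 0 0 = (P'⁻¹ * M * P').val 0 0 ∧
        (P⁻¹ * M * P).val 1 1 = (P'⁻¹ * M * P').val 1 1) ∨
      ((P⁻¹ * M * P).val 0 0 = (P'⁻¹ * M * P').val 1 1 ∧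
        (P⁻¹ * M * P).val 1 1 = (P'⁻¹ * M * P').val 0 0) := by
  have htr : ∀ Q : GL (Fin 2) K,
      (Q⁻¹ * M * Q).val 0 0 + (Q⁻¹ * M * Q).val 1 1 = M.val 0 0 + M.val 1 1 := fun Q => by
    rw [← Matrix.trace_fin_two, ← Matrix.trace_fin_two, Units.val_mul, Units.val_mul]
    exact Matrix.trace_units_conj' Q M.val
  have hdet : ∀ Q : GL (Fin 2) K, (Q⁻¹ * M * Q).val 1 0 = 0 →
      (Q⁻¹ * M * Q).val 0 0 * (Q⁻¹ * M * Q).val 1 1 = M.val.det := fun Q hQ => by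
    have h : (Q⁻¹ * M * Q).val.det = M.val.det := by
      rw [Units.val_mul, Units.val_mul]
      exact Matrix.det_units_conj' Q M.val
    rw [Matrix.det_fin_two, hQ, mul_zero, sub_zero] at h
    exact h
  have ht : (P⁻¹ * M * P).val 0 0 + (P⁻¹ * M * P).val 1 1 =
      (P'⁻¹ * M * P').val 0 0 + (P'⁻¹ * M * P').val 1 1 := (htr P).trans (htr P').symm
  have hd : (P⁻¹ * M * P).val 0 0 * (P⁻¹ * M * P).val 1 1 =
      (P'⁻¹ * M * P').val 0 0 * (P'⁻¹ * M * P').val 1 1 := (hdet P hP).trans (hdet P' hP').symm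
  have key : ((P⁻¹ * M * P).val 0 0 - (P'⁻¹ * M * P').val 0 0) *
      ((P⁻¹ * M * P).val 0 0 - (P'⁻¹ * M * P').val 1 1) = 0 := by
    linear_combination (P⁻¹ * M * P).val 0 0 * ht - hd
  rcases mul_eq_zero.mp key with h | h
  · exact Or.inl ⟨sub_eq_zero.mp h, by linear_combination ht - sub_eq_zero.mp h⟩
  · exact Or.inr ⟨sub_eq_zero.mp h, by linear_combination ht - sub_eq_zero.mp h⟩

variable {F : Type} [Field F] [NumberField F] {p : ℕ}
variable {𝒪 : Type} [CommRing 𝒪] {k : Type} [Field k] [Algebra 𝒪 k] {𝒟 : NearlyOrdinaryDatum F p 𝒪 k}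

/-- **The Steinberg pin (one Frobenius, any frame).**  Let `𝔮 ∈ steinbergLocus 𝓡 w`, `𝔓 ∣ w`, `σ` an
arithmetic Frobenius at `𝔓`, and `P` ANY frame over `Frac(R/𝔮)` with `(P⁻¹ ρ_𝔮(σ) P)₁₀ = 0`.  Then the
diagonal entries `a = (P⁻¹ ρ_𝔮(σ) P)₀₀`, `d = (P⁻¹ ρ_𝔮(σ) P)₁₁` satisfy `a = N w · d ∨ d = N w · a`.
Proof: `IsSteinbergShapedAt` gives a local frame `P'` at `𝔓` with `P'⁻¹ ρ_𝔮 P'` upper triangular on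
`D_𝔓 ∋ σ` (`IsArithFrobAt.mem_stabilizer`) and `a' = N w · d'`; by `diag_eq_or_eq_swap_of_conj`,
`(a, d) ∈ {(a', d'), (d', a')}`.  (At a REDUCIBLE Steinberg-shaped `𝔮` this is the hyperplane
`Ψ(Frob_w) = q_w^{±1}` of `steinberg_hyperplane`, now in an arbitrary global reducible frame.) [folklore] -/
theorem steinbergPin_of_apply (𝓡 : NearlyOrdinaryDeformationRing.{0} 𝒟) {w : HeightOneSpectrum (𝓞 F)}
    {𝔮 : PrimeSpectrum 𝓡.R} (h𝔮 : 𝔮 ∈ steinbergLocus 𝓡 w) {𝔓 : Ideal (absIntegers (𝓞 F) F)}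
    (h𝔓 : 𝔓 ∈ w.primesAbove) {σ : absoluteGaloisGroup F} (hσ : IsArithFrobAt (𝓞 F) σ 𝔓)
    (P : GL (Fin 2) (FractionRing (𝓡.R ⧸ 𝔮.asIdeal))) (hP : (P⁻¹ * fracModPrime 𝓡 𝔮 σ * P).val 1 0 = 0) :
    (P⁻¹ * fracModPrime 𝓡 𝔮 σ * P).val 0 0 =
        (Ideal.absNorm w.asIdeal : FractionRing (𝓡.R ⧸ 𝔮.asIdeal)) *
          (P⁻¹ * fracModPrime 𝓡 𝔮 σ * P).val 1 1 ∨
      (P⁻¹ * fracModPrime 𝓡 𝔮 σ * P).val 1 1 =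
        (Ideal.absNorm w.asIdeal : FractionRing (𝓡.R ⧸ 𝔮.asIdeal)) *
          (P⁻¹ * fracModPrime 𝓡 𝔮 σ * P).val 0 0 := by
  obtain ⟨P', hup, -, hfrob⟩ := h𝔮 𝔓 h𝔓
  haveI := h𝔓.1
  have hmem : σ ∈ 𝔓.decompositionSubgroup (absoluteGaloisGroup F) := hσ.mem_stabilizer
  have hq := hfrob σ hσ
  rcases diag_eq_or_eq_swap_of_conj (fracModPrime 𝓡 𝔮 σ) P P' hP (hup σ hmem) with ⟨h0, h1⟩ | ⟨h0, h1⟩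
  · exact Or.inl (h0.trans (hq.trans (congrArg _ h1.symm)))
  · exact Or.inr (h1.trans (hq.trans (congrArg _ h0.symm)))

/-- **The Steinberg pin in a global upper-triangular frame** (the form the heart consumes: `P` a
reducible frame of `ρ_𝒟 mod 𝔮`, `𝔮 ∈ reducibleLocus ∩ steinbergLocus w`): at every arithmetic Frobenius
`σ` at `𝔓 ∣ w`, `a(σ) = N w · d(σ) ∨ d(σ) = N w · a(σ)`. [folklore] -/
theorem steinbergPin (𝓡 : NearlyOrdinaryDeformationRing.{0} 𝒟) {w : HeightOneSpectrum (𝓞 F)}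
    {𝔮 : PrimeSpectrum 𝓡.R} (h𝔮 : 𝔮 ∈ steinbergLocus 𝓡 w)
    (P : GL (Fin 2) (FractionRing (𝓡.R ⧸ 𝔮.asIdeal)))
    (hP : ∀ γ, (P⁻¹ * fracModPrime 𝓡 𝔮 γ * P).val 1 0 = 0) {𝔓 : Ideal (absIntegers (𝓞 F) F)}
    (h𝔓 : 𝔓 ∈ w.primesAbove) {σ : absoluteGaloisGroup F} (hσ : IsArithFrobAt (𝓞 F) σ 𝔓) :
    (P⁻¹ * fracModPrime 𝓡 𝔮 σ * P).val 0 0 =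
        (Ideal.absNorm w.asIdeal : FractionRing (𝓡.R ⧸ 𝔮.asIdeal)) *
          (P⁻¹ * fracModPrime 𝓡 𝔮 σ * P).val 1 1 ∨
      (P⁻¹ * fracModPrime 𝓡 𝔮 σ * P).val 1 1 =
        (Ideal.absNorm w.asIdeal : FractionRing (𝓡.R ⧸ 𝔮.asIdeal)) *
          (P⁻¹ * fracModPrime 𝓡 𝔮 σ * P).val 0 0 :=
  steinbergPin_of_apply 𝓡 h𝔮 h𝔓 hσ P (hP σ)

/-- **Character form of the pin** (the frame written as `MulAut.conj P⁻¹ ∘ ρ_𝔮`, as in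
`HasFiniteOrderRatio`): the diagonal characters `ψ₀, ψ₁ = Deformation.diagChar _ hP 0, 1` satisfy
`ψ₀(σ) = N w · ψ₁(σ) ∨ ψ₁(σ) = N w · ψ₀(σ)` at every arithmetic Frobenius `σ` at `𝔓 ∣ w`. [folklore] -/
theorem steinbergPin_diagChar (𝓡 : NearlyOrdinaryDeformationRing.{0} 𝒟) {w : HeightOneSpectrum (𝓞 F)}
    {𝔮 : PrimeSpectrum 𝓡.R} (h𝔮 : 𝔮 ∈ steinbergLocus 𝓡 w)
    (P : GL (Fin 2) (FractionRing (𝓡.R ⧸ 𝔮.asIdeal)))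
    (hP : ∀ γ, (((MulAut.conj P⁻¹).toMonoidHom.comp (fracModPrime 𝓡 𝔮)) γ).val 1 0 = 0)
    {𝔓 : Ideal (absIntegers (𝓞 F) F)} (h𝔓 : 𝔓 ∈ w.primesAbove) {σ : absoluteGaloisGroup F}
    (hσ : IsArithFrobAt (𝓞 F) σ 𝔓) :
    (Deformation.diagChar _ hP 0 σ : FractionRing (𝓡.R ⧸ 𝔮.asIdeal)) =
        (Ideal.absNorm w.asIdeal : FractionRing (𝓡.R ⧸ 𝔮.asIdeal)) * Deformation.diagChar _ hP 1 σ ∨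
      (Deformation.diagChar _ hP 1 σ : FractionRing (𝓡.R ⧸ 𝔮.asIdeal)) =
        (Ideal.absNorm w.asIdeal : FractionRing (𝓡.R ⧸ 𝔮.asIdeal)) * Deformation.diagChar _ hP 0 σ := by
  have hconj : ∀ γ, ((MulAut.conj P⁻¹).toMonoidHom.comp (fracModPrime 𝓡 𝔮)) γ =
      P⁻¹ * fracModPrime 𝓡 𝔮 γ * P := fun γ => by
    rw [MonoidHom.comp_apply, MulEquiv.coe_toMonoidHom, MulAut.conj_apply, inv_inv]
  simp only [Deformation.coe_diagChar_apply, hconj]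
  exact steinbergPin_of_apply 𝓡 h𝔮 h𝔓 hσ P (by rw [← hconj]; exact hP σ)

/-- **Ratio form of the pin**: if `q = N w` is non-zero in `Frac(R/𝔮)` (e.g. `w ∤ char`), the ratio
`Ψ = ψ₀/ψ₁` takes the value `q` or `q⁻¹` at every arithmetic Frobenius at `𝔓 ∣ w` — the reducible
Steinberg-shaped points of `Spec R_𝒟` lie on the two hyperplanes `Ψ(Frob_w) = q_w^{±1}`. [folklore] -/
theorem steinbergPin_ratio (𝓡 : NearlyOrdinaryDeformationRing.{0} 𝒟) {w : HeightOneSpectrum (𝓞 F)}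
    {𝔮 : PrimeSpectrum 𝓡.R} (h𝔮 : 𝔮 ∈ steinbergLocus 𝓡 w)
    (P : GL (Fin 2) (FractionRing (𝓡.R ⧸ 𝔮.asIdeal)))
    (hP : ∀ γ, (((MulAut.conj P⁻¹).toMonoidHom.comp (fracModPrime 𝓡 𝔮)) γ).val 1 0 = 0)
    {𝔓 : Ideal (absIntegers (𝓞 F) F)} (h𝔓 : 𝔓 ∈ w.primesAbove) {σ : absoluteGaloisGroup F}
    (hσ : IsArithFrobAt (𝓞 F) σ 𝔓)
    (hq : (Ideal.absNorm w.asIdeal : FractionRing (𝓡.R ⧸ 𝔮.asIdeal)) ≠ 0) :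
    Deformation.diagChar _ hP 0 σ / Deformation.diagChar _ hP 1 σ = Units.mk0 _ hq ∨
      Deformation.diagChar _ hP 0 σ / Deformation.diagChar _ hP 1 σ = (Units.mk0 _ hq)⁻¹ := by
  rcases steinbergPin_diagChar 𝓡 h𝔮 P hP h𝔓 hσ with h | h
  · refine Or.inl (Units.ext ?_)
    rw [Units.val_div_eq_div_val, Units.val_mk0, div_eq_iff (Units.ne_zero _), h]
  · refine Or.inr (Units.ext ?_)
    rw [Units.val_div_eq_div_val, Units.val_inv_eq_inv_val, Units.val_mk0,
      div_eq_iff (Units.ne_zero _), h, ← mul_assoc, inv_mul_cancel₀ hq, one_mul]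

end Pin

/-! ## 4. Registered wrapper -/

/-- **Registered sub-goal of `stub_smallReducibleSteinbergLocusAligned` (this helper file): the Steinberg
pin at reducible Steinberg-shaped primes** (= `steinbergPin` with explicit binders; the reducibility
half of the hypothesis is what supplies the global frame `P` in the heart's use). [folklore] -/
theorem stub_smallReducibleSteinbergLocusAligned_auxSteinbergPin :
    ∀ (F : Type) [Field F] [NumberField F] (p : ℕ) (𝒪 : Type) [CommRing 𝒪] (k : Type) [Field k] [Algebra 𝒪 k] (𝒟 : NearlyOrdinaryDatum F p 𝒪 k) (𝓡 : NearlyOrdinaryDeformationRing.{0} 𝒟) (w : HeightOneSpectrum (𝓞 F)) (𝔮 : PrimeSpectrum 𝓡.R), 𝔮 ∈ 𝓡.reducibleLocus ∩ steinbergLocus 𝓡 w → ∀ (P : GL (Fin 2) (FractionRing (𝓡.R ⧸ 𝔮.asIdeal))), (∀ γ, (P⁻¹ * fracModPrime 𝓡 𝔮 γ * P).val 1 0 = 0) → ∀ 𝔓 ∈ w.primesAbove, ∀ σ : absoluteGaloisGroup F, IsArithFrobAt (𝓞 F) σ 𝔓 → (P⁻¹ * fracModPrime 𝓡 𝔮 σ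 * P).val 0 0 = (Ideal.absNorm w.asIdeal : FractionRing (𝓡.R ⧸ 𝔮.asIdeal)) * (P⁻¹ * fracModPrime 𝓡 𝔮 σ * P).val 1 1 ∨ (P⁻¹ * fracModPrime 𝓡 𝔮 σ * P).val 1 1 = (Ideal.absNorm w.asIdeal : FractionRing (𝓡.R ⧸ 𝔮.asIdeal)) * (P⁻¹ * fracModPrime 𝓡 𝔮 σ * P).val 0 0 :=
  fun _ _ _ _ _ _ _ _ _ _ 𝓡 _ _ h𝔮 P hP _ h𝔓 _ hσ => steinbergPin 𝓡 h𝔮.2 P hP h𝔓 hσ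

end

end Summit.Langlands.Langlands.Cruxes.ReducibleOrdinaryProModular.SteinbergHyperplane
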